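import Literature.MathematicalPhysics.QuantumFieldTheory.Balaban1983to89.B8Thm2TorusOfCubeDataDeltaASide
import Literature.MathematicalPhysics.QuantumFieldTheory.Balaban1983to89.B9Eq335CubeDatumOfReg335Zd
import Literature.MathematicalPhysics.QuantumFieldTheory.Balaban1983to89.B8Prop6Reg335ZdAllTorus

/-!
# `Balaban1983to89.B8Thm2TorusOfProp6DeltaASide` — sub-row G-B8-T2S, file G5: [Balaban1985RegularSpaces] THEOREM 2 ON THE TORUS `T_η` FOR `SU(N)` WITH THE
# REGULARITY CONDITION (3.35) DROPPED BY PROPOSITION 6 (p. 82 «We will see later that this condition is a consequence of the first one in (1.33), so eventually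
# we will drop it out of the assumptions», p. 99 «hence for α₀ sufficiently small we have proved the regularity condition (3.35)») — the torus assembler's
# endpoint displayed modulo the six Δ_a-side members of [B9] §3 ALONE (OFFER (α) of p33 g100 DISCHARGED: G3 ∘ G4 ∘ pub-ymgap's unconditional
# `B8Prop6Reg335ZdAllTorus.prop6At_bgZd_allTorus_holds`)

statement-level skeleton of published theorems with citation tags; proofs where landed; nothing here is a claim about the
Yang–Mills mass gap

T. Bałaban, *Spaces of regular gauge field configurations on a lattice and gauge fixing conditions*, Commun. Math. Phys. **99** (1985) 75–102
[`Balaban1985RegularSpaces`, "[B8]"]: Thm 2 p. 83, (1.33)–(1.39) pp. 82–83, p. 82 («eventually we will drop it out»), Prop. 6 (1.135)–(1.138) p. 99, p. 98 («we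
take a size of □ equal to MLʲη»), p. 77 («Ω_j = T_η for j = 0,1,…,l, l ≤ k»), p. 76 («G = SU(N)»), Prop. 3 (1.58)–(1.60) pp. 86–87.  T. Bałaban, *Propagators
for lattice gauge theories in a background field*, Commun. Math. Phys. **99** (1985) 389–434 [`Balaban1985BackgroundPropagators`, "[B9]"]: (3.35)–(3.37) p. 396
(the cube class: «□ is a union of several big blocks of the lattice T_{Lʲη} … O(1) will mean a number ≤ 10»), Thm 3.1 p. 397, Thm 3.2 p. 398, Thm 3.3 p. 399, Thm
3.4 p. 400, Thm 3.11 p. 416.  [4] = [`Balaban1984PropagatorsII`] (2.1)–(2.4) p. 224, Lemma 2.1 pp. 233–234.  [`Balaban1985Averaging`] (4) p. 18, Prop. 2 p. 26.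
[`Balaban1985UV3`] (1)–(3) p. 256.

WHY ∕ THE ARGUMENT.  G3 `B8Thm2TorusOfCubeDataDeltaASide.thm2SetupSUAt_ofCubeData_deltaASide_exists` displays two analytic families: (α) per member `i` (constant
level `n`, `i.k = n + 1`, `M_h = L^a`), cube `□` and `SU(N)`-valued `P₀`-periodic `U₀ ∈ 𝔄_n(T_η, α₀)`, FILE 16's per-cube (3.35) datum for `bgY i U₀`; (Δa) the
Δ_a-side members.  (α) IS [B8]'s hypothesis «U₀ satisfies the regularity condition (3.35) in [4]», which print removes by Proposition 6; pub-ymgap's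
`prop6At_bgZd_allTorus_holds` (dag-n05-e; `d ≥ 2`, `L ≥ 5` odd; UNCONDITIONAL) proves exactly that at every all-torus `ℤ^{d+1}` member: for every block
parameter `M ≥ 1` and truncation `m`, `U₀ ∈ 𝔄_m(T_η, α₀)` with `Mα₀ ≤ c₆` has the (3.35) datum on every cube of [4]'s p. 396 class of index `j ≤ m` at the scale
`Lʲη` with constant `c₃₅·M·K₆·α₀`.  §1 reads it on the `ℤ^{d+1}` cube the carrier bridge G4 wants: for a cube `□` of level `j` of the member, the ALIGNED cube
`B` of side `2·(10·L·M_h)·Lʲ = 20·S_j` whose lower corner is the `10S_j`-grid point below `ctrC □ − (35S_j∕8 + 2)` — a class cube of index `j` of the all-torus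
member `torusIdx ⟨η, j⟩` at block parameter `M := 10·L·M_h` and truncation `m := j` (there `Ω_{j+1} = Ω_{j+2} = ∅` in the truncated sequence, so the class
conditions «□ ∩ Ω_{j+2} = ∅», «□ ⊄ Ω_{j+1}» hold, and `□ ⊆ Ω_j = ℤ^{d+1}`) — containing the sup-ball of radius `35S_j∕8 + 2` about `ctrC □`; `𝔄_j ⊇ 𝔄_n` for
`j ≤ n` is not even needed: the cube's level IS `n`.  §2 feeds §1 into G4 `cubeDatum_of_reg335Zd` (room inequality from `N = M_h·L^{k+1}·P′ ≥ 25S_n`) and the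
result into G3, choosing the data per cube by `choose`; the smallness is ONE threshold `c_α = min (c₆∕(10L·L^a)) (min a₁ ¼ ∕ (c₃₅·(10L·L^a)·K₆·L²·(1 + D₁θ) + 1))`
on `c_L` (existential, since `c₃₅, c₆, K₆` are); §3 is the 19200 dictionary's `T3Family` form.

WHAT IS PROVED (kernel; 0 `def`, 0 `… : Prop` fact, 0 sorry; standard axioms).
* §1 ★★ `reg335Cube_ball_of_prop6At` — Prop. 6's (3.35) datum ON THE ALIGNED `ℤ^{d+1}` CUBE CONTAINING THE CHART BALL of a member's cube, from the `Prop6At` binder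
  at the all-torus member (`M := 10·L·M_h`, truncation = the cube's level).
* §2 ★★★★★ `thm2SetupSUAt_ofProp6_deltaASide_exists` — `1 ≤ N ≤ 25`, `d + 1 ≥ 2`, odd `L = ℓ + 1 ≥ 5`; τ = tr with `C_τ`; `M ≥ 1`, `B₀ > 0`, `a_T` in the windows with
  F7's numeric condition; `len`; basis `b`, `M₂`; `Rr, Hp`: `∃ a₀′ > 0, ∃ k₀, ∃ c_α > 0, ∀ c_L > 0` with `c_L·L² < a₀′`, `c_L ≤ c_P`, `c_L ≤ c_α`: `∃ B₁ B₂ c₁ > 0`,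
  `∀ m K k η` (`1 ≤ k`, `k + k₀ ≤ m + K`, `η > 0`): (Δa) [F10's binder at `K′ = k`] → `Thm2SetupSUAt (PV d ℓ m K hd hL) N k η 0 B₁ B₂ c₁ len (fun _ => True)`.
* §3 ★★★★★ `hThm2_of_prop6_deltaASide` — the 19200 `hThm2` binder form (`d + 1 = 3`, `N = 2`): `… ∃ B₁ B₂ c₁ > 0, ∀ F : T3Family, F.L = ℓ + 1 → ∀ n < K,
  k₀ ≤ F.m + n → (Δa) → ∃ β₀ B₂′ len′, Thm2SetupSUAt (F.P K) 2 (K − n) (eta F n K) β₀ B₁ B₂′ c₁ len′ (fun _ => True)`.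

HONEST SCOPE ∕ NOT CLAIMED.  Composition BY NAME (G3, G4, pub-ymgap's Prop. 6 theorem, A13's `P_eq_PV`) with threshold bookkeeping; NO estimate of [B8] ∕ [B9] ∕ [4]
is proved IN THIS FILE ([B8] Prop. 6 and the γ flat line behind it are pub-ymgap's theorems; [B9] Thm 3.1 ∕ 3.2 are p33's FILES 12–14; the (B)-arrow junction is
t2s-1 g6–g8's).  What REMAINS displayed: (Δa) — `Δ_a(U)` invertible with the three weighted bounds of `G_a(U) = Δ_a(U)⁻¹` at a uniform `B₀`, `Δ′_a(U)` and `X(U)`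
invertible, at every shape-member and every `U(N)`-valued background of the class ([B9] Thms 3.3∕3.4∕3.11 at def-Y's letters; cell gaps G-B9-02 ff., the
G-B9-LETTERS road).  Located volume threshold `k + k₀ ≤ m + K` (`k₀ ≤ F.m + n`); `SU(N)`, `N ≤ 25`; sup-entries only (`β₀ = 0`); the uniqueness half of Thm 2 is
NOT produced (existence half, as the 19200 consumer reads); DESIGN constants (`M := 10·L·M_h`, side `20S_j`, `c_α`, `B₁`); count-neutral; no summit ∕
sub-problem statement is proved; NOT a node discharge; `stub_PV3A` NOT discharged; nothing continuum ∕ ℝ⁴ ∕ OS ∕ mass-gap ∕ Clay — the Yang–Mills mass gap is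
NOT proved by any of this.  No `sorry`, no `axiom`, no `def`, no `instance`, no `notation`.  NEW file; nothing landed is modified.  Cell `lit-balaban`, seat
`lit-balaban-t2s-1` gen 9, 2026-08-28; `--supports stmt-QuantumFields-19200`.
-/

noncomputable section

open scoped BigOperators

namespace Literature.MathematicalPhysics.QuantumFieldTheory.Balaban1983to89.B8Thm2TorusOfProp6DeltaASide

open Node00 B6KLevelCensusIndexV1 B9Eq39Adjoint
open B7Prop1Explicit renaming Site → LSite
open B7Prop1Explicit (e)
open B7Prop2Explicit (unitaryUnits C0 c2')
open B4PartitionUnity22 (thetaProf D1)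
open B6Cover236MultiLevelBlocks (cubes)
open B6GlobalChartV1 (PV boxEquiv)
open B9BackgroundsKLevelV1 (shiftsV1)
open B9Eq360DeltaPrimeAY (AfldY)
open B9GeoNormsKLevelV1 (geo9K)
open B9Cor36CubeCutoffs (SC NearC one_le_SC nine_le_SC)
open B9CubeSequence408 (ctrC)
open B8Ineq132 (InAk)
open B8LeafModelZd (ZdIdx)
open B8Thm2TorusLettersPerOfKnit (bgY)
open B9B8AveragingJunction (parKnitY)
open B9Eq316AveragingTransposeZd (qQ betaTau alphaQ)
open B7Prop2SpecialUnitary (specialUnitaryUnits specialUnitaryUnits_le_unitaryUnits)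
open B8Thm2SetupTorus (Thm2SetupSUAt)
open B8Thm2TorusOfCubeDataDeltaASide (thm2SetupSUAt_ofCubeData_deltaASide_exists)
open B9Eq335CubeDatumOfReg335Zd (cubeDatum_of_reg335Zd)
open B8Eq133Hypotheses (shiftT byDir Reg335Zd)
open B9Eq335RegularityClasses (Reg335Cube)
open B8Thm2TorusMember (TorusMember torusIdx)
open B9SupplySockB9P3ZdAt (Prop6At)
open B9SupplySockB9P3ZdFrame (memZd bgZd ιCfgZd cubeClass396Zd IsCube396Zd boxZd bigSideZd OmTrunc reg335_bgZd_iff omTrunc_of_le omTrunc_of_lt)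
open B8Prop6Reg335ZdAllTorus (prop6At_bgZd_allTorus_holds)
open B8Thm2T3FamilyBinder (P_eq_PV)
open T3ContinuumYM3Torus (T3Family)
open T3SectALandauChart (eta eta_pos)
open T4TermwiseTorus (IsPeriodic)
open LatticeNorms (scaleLen)
open scoped Matrix Matrix.Norms.L2Operator

variable {d ℓ : ℕ} {hd : 1 ≤ d + 1} {hL : Odd (ℓ + 1) ∧ 1 < ℓ + 1} {b₀ b₁ : ℝ}

/-! ## §1 ★★ Prop. 6's (3.35) datum on the aligned `ℤ^{d+1}` cube containing the chart ball of a member's cube -/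

section Ball

variable {𝔸 : Type} [CStarAlgebra 𝔸]

/-- ★★ **PROPOSITION 6's (3.35) DATUM ON THE ALIGNED CUBE CONTAINING THE CHART BALL.**  For a member `i`, a cube `□ = c` of its cover (level `j`, big-block side
`S_j = M_h·L^{j+1}`), a `U(N)`-type background `U₀ ∈ 𝔄_j(T_η, α₀)` on `ℤ^{d+1}` and the `Prop6At` binder of [B8] Prop. 6 at the all-torus members (pub-ymgap's
shape; `hP6`): if `(10·L·M_h)·α₀ ≤ c₆` then on the aligned cube `B` of side `20S_j` below `ctrC □ − (35S_j∕8 + 2)` — which contains the sup-ball of radius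
`35S_j∕8 + 2` about `ctrC □` and is a cube of [4]'s p. 396 class of index `j` for the member `torusIdx ⟨η, j⟩` truncated at `j`, block parameter `10·L·M_h` — the
datum `Reg335Cube (shiftT (d+1)) (byDir U₀) η B (Lʲη) (c₃₅·(10·L·M_h)·(K₆α₀))` holds.
[cite: Balaban1985RegularSpaces, Prop. 6 p.99, p.98 («we take a size of □ equal to MLʲη»), (1.33) p.82; Balaban1985BackgroundPropagators, (3.35) p.396 (the cube class, «O(1) … ≤ 10»)] -/
theorem reg335Cube_ball_of_prop6At {c35 c₆ K₆ : ℝ}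
    (hP6 : ∀ (M : ℝ) (t : ZdIdx (d + 1) (ℓ + 1)) (m : ℕ), (∀ j, t.Ω j = Set.univ) → 1 ≤ M →
      Prop6At (bgZd 𝔸 (ℓ + 1)) (ℓ + 1) memZd (ιCfgZd 𝔸 (ℓ + 1)) c35 c₆ K₆ M t m)
    (i : KIdx d ℓ hd hL b₀ b₁) (c : ↥(cubes (toKT i).D.toDomains))
    {η α₀ : ℝ} (hη : 0 < η) (hα₀ : 0 < α₀) (hsmall : ((10 * (ℓ + 1) * (toKT i).Mh : ℕ) : ℝ) * α₀ ≤ c₆)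
    {U₀ : LSite (d + 1) → Fin (d + 1) → 𝔸ˣ} (hU₀ : ∀ x κ, U₀ x κ ∈ unitaryUnits 𝔸)
    (hA : InAk (ℓ + 1) c.1.1 η α₀ (fun _ => (Set.univ : Set (LSite (d + 1)))) U₀) :
    ∃ B : Set (LSite (d + 1)), (∀ z : LSite (d + 1), (∀ μ, |z μ - ctrC c μ| ≤ 35 * SC i c / 8 + 2) → z ∈ B) ∧
      Reg335Cube (shiftT (d + 1)) (byDir U₀) η B (scaleLen (((ℓ + 1 : ℕ) : ℝ)) η c.1.1)
        (c35 * (((10 * (ℓ + 1) * (toKT i).Mh : ℕ) : ℝ)) * (K₆ * α₀)) := by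
  -- the all-torus member at spacing `η`, `j` levels, truncated at `j`, block parameter `M := 10·L·M_h`
  have hj1 : 1 ≤ c.1.1 := B9CubeSequence408.one_le_cube_level c
  set t : ZdIdx (d + 1) (ℓ + 1) := torusIdx (d := d + 1) (by omega) ⟨η, hη, c.1.1, hj1⟩ with ht
  set Mn : ℕ := 10 * (ℓ + 1) * (toKT i).Mh with hMn
  set M : ℝ := ((Mn : ℕ) : ℝ) with hM
  have hMh := (toKT i).hMh
  have hMn1 : 1 ≤ Mn := by rw [hMn]; nlinarith
  have hM1 : (1 : ℝ) ≤ M := by rw [hM]; exact_mod_cast hMn1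
  have hΩ : ∀ j, t.Ω j = Set.univ := fun _ => rfl
  -- Prop. 6 at this member
  have h6 := hP6 M t c.1.1 hΩ hM1 α₀ U₀ hU₀ hα₀ hsmall hA
  rw [reg335_bgZd_iff] at h6
  -- `h6 : Reg335Zd η L (cubeClass396Zd L x) (c35 * M * (K₆ * α₀)) U₀`
  -- the aligned cube: side `2 · bigSideZd M L j`, `bigSideZd M L j = Mn · L^j = 10 S_j`
  have hceil : ⌈M⌉₊ = Mn := by rw [hM]; exact Nat.ceil_natCast Mn
  have hbig : (bigSideZd M (ℓ + 1) c.1.1 : ℤ) = 10 * SC i c := by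
    unfold bigSideZd
    rw [hceil, hMn]
    show (((10 * (ℓ + 1) * (toKT i).Mh * (ℓ + 1) ^ c.1.1 : ℕ)) : ℤ) = 10 * ((B6MultiLevelBoxOperator.bigSide ℓ (toKT i).Mh c.1.1 : ℕ) : ℤ)
    unfold B6MultiLevelBoxOperator.bigSide
    push_cast
    ring
  set s : ℤ := (bigSideZd M (ℓ + 1) c.1.1 : ℤ) with hs
  have hs0 : 0 < s := by rw [hbig]; have := one_le_SC i c; omega
  have hbs0 : 0 < bigSideZd M (ℓ + 1) c.1.1 := by have h := hs0; rw [hs] at h; exact_mod_cast h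
  set R : ℤ := 35 * SC i c / 8 + 2 with hR
  set corner : LSite (d + 1) := fun μ => s * ((ctrC c μ - R) / s) with hcorner
  set B : Set (LSite (d + 1)) := boxZd corner (2 * bigSideZd M (ℓ + 1) c.1.1) with hB
  have hSC9 := nine_le_SC i c
  -- the ball lies in `B`
  have hball : ∀ z : LSite (d + 1), (∀ μ, |z μ - ctrC c μ| ≤ R) → z ∈ B := by
    intro z hz μ
    have h1 := abs_le.1 (hz μ)
    have hfl : s * ((ctrC c μ - R) / s) ≤ ctrC c μ - R := Int.mul_ediv_self_le (by omega)
    have hfl' : ctrC c μ - R < s * ((ctrC c μ - R) / s) + s := by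
      have := Int.lt_mul_ediv_self_add (x := ctrC c μ - R) hs0
      linarith
    refine ⟨by simp only [hcorner]; linarith, ?_⟩
    have h2s : ((2 * bigSideZd M (ℓ + 1) c.1.1 : ℕ) : ℤ) = 2 * s := by rw [hs]; push_cast; ring
    rw [h2s]
    simp only [hcorner]
    have hRs : 2 * R ≤ s := by rw [hR, hbig]; omega
    linarith
  refine ⟨B, hball, ?_⟩
  -- `(B, j)` is a class cube of the truncated member
  have hmem : (B, c.1.1) ∈ cubeClass396Zd (ℓ + 1) (memZd M t c.1.1) := by
    rw [B9SupplySockB9P3ZdFrame.mem_cubeClass396Zd_iff]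
    refine ⟨le_rfl, ⟨corner, 2, by norm_num, by norm_num, fun μ => ?_, rfl⟩, ?_, ?_, ?_⟩
    · exact Dvd.intro _ rfl
    · rw [omTrunc_of_le (memZd M t c.1.1) (show c.1.1 ≤ (memZd M t c.1.1).m from le_rfl)]
      intro z _
      show z ∈ t.Ω c.1.1
      rw [hΩ]; exact Set.mem_univ _
    · rw [omTrunc_of_lt (memZd M t c.1.1) (show (memZd M t c.1.1).m < c.1.1 + 2 from by show c.1.1 < c.1.1 + 2; omega)]
      exact Set.disjoint_empty _
    · refine ⟨corner, B9SupplySockB9P3ZdFrame.mem_boxZd_self corner (by omega), ?_⟩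
      rw [omTrunc_of_lt (memZd M t c.1.1) (show (memZd M t c.1.1).m < c.1.1 + 1 from by show c.1.1 < c.1.1 + 1; omega)]
      exact Set.notMem_empty _
  have h := h6 (B, c.1.1) hmem
  -- the member's letters unfolded: `η`, `M`, `U₀`
  change Reg335Cube (shiftT (d + 1)) (byDir U₀) η B (scaleLen (((ℓ + 1 : ℕ) : ℝ)) η c.1.1) (c35 * M * (K₆ * α₀)) at h
  exact h

end Ball

/-! ## §2 ★★★★★ [B8] Thm 2 at the `SU(N)`-valued Setup-torus objects, (3.35) dropped by Prop. 6: modulo the Δ_a-side members alone -/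

section Setup

variable {N : ℕ} [NeZero N]
variable [instF : ∀ i : KIdx d ℓ hd hL 1 1, Fintype (geo9K i).Site] [instD : ∀ i : KIdx d ℓ hd hL 1 1, DecidableEq (geo9K i).Site]

/-- ★★★★★ **[B8] THM 2 AT THE `SU(N)`-VALUED SETUP-TORUS OBJECTS OF EVERY `PV d ℓ m K` WITH `k + k₀ ≤ m + K`, FROM THE SIX Δ_a-SIDE MEMBERS OF [B9] §3 ALONE —
the regularity condition (3.35) of (1.33) DROPPED by Proposition 6** (`1 ≤ N ≤ 25`, `d + 1 ≥ 2`, odd `L = ℓ + 1 ≥ 5`; `τ = tr` with `C_τ`; `M ≥ 1`, `B₀ > 0`, `a_T` in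
the windows with F7's numeric condition; `len`; basis `b`, `M₂`; `Rr, Hp`).  `∃ a₀′ > 0, ∃ k₀, ∃ c_α > 0, ∀ c_L > 0` with `c_L·L² < a₀′`, `c_L ≤ c_P`, `c_L ≤ c_α`,
`∃ B₁ B₂ c₁ > 0, ∀ m K k η` (`1 ≤ k`, `k + k₀ ≤ m + K`, `η > 0`): (Δa) [F10's binder VERBATIM at `K′ = k`: at every shape-member `i : KIdx d ℓ hd hL 1 1` of constant
level `1 ≤ m′ ≤ k`, every `0 < α₀ ≤ a_T`, every `U(N)`-valued `P₀`-periodic `U₀ ∈ 𝔄_{m′}(T_η, α₀)`: `IsUnit Δ_a`, the three weighted bounds of `G_a` at `B₀`,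
`IsUnit Δ′_a`, `IsUnit X`] → `Thm2SetupSUAt (PV d ℓ m K hd hL) N k η 0 B₁ B₂ c₁ len (fun _ => True)`.  HONEST SCOPE: (Δa) displayed, inhabited by nothing here;
everything else is a theorem upstream (G1–G4, F10, F16′s FILES 12–15, pub-ymgap's Prop. 6); `stub_PV3A` NOT discharged; the Yang–Mills mass gap is NOT proved.
[cite: Balaban1985RegularSpaces, Thm 2 p.83, (1.33)–(1.39) pp.82–83, p.82 («eventually we will drop it out of the assumptions»), Prop. 6 p.99, p.77 («Ω_j = T_η»), p.76 («G = SU(N)»), (1.58)–(1.60) pp.86–87; Balaban1985BackgroundPropagators, (3.35)–(3.37) p.396, Thm 3.1 p.397, Thm 3.2 p.398, Thm 3.3 p.399, Thm 3.4 p.400, Thm 3.11 p.416; Balaban1984PropagatorsII, (2.1)–(2.4) p.224, Lemma 2.1 pp.233–234; Balaban1985Averaging, (4) p.18, Prop. 2 p.26] -/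
theorem thm2SetupSUAt_ofProp6_deltaASide_exists (hN : N ≤ 25) (hd2 : 2 ≤ d + 1) (hℓ : 4 ≤ ℓ)
    (τ : Matrix (Fin N) (Fin N) ℂ →ₗ[ℂ] ℂ) (hτ : ∀ a, τ a = Matrix.trace a) (hτt : ∀ a b, τ (a * b) = τ (b * a))
    {Cτ : ℝ} (hCτ : ∀ x y : Matrix (Fin N) (Fin N) ℂ, |(τ (star x * y)).re| ≤ Cτ * ‖x‖ * ‖y‖)
    {M : ℝ} (hM1 : 1 ≤ M) {B₀ aT : ℝ} (hB₀ : 0 < B₀) (haT : 0 < aT) (haTQ : aT ≤ alphaQ (d + 1) (ℓ + 1) / ((ℓ + 1 : ℕ) : ℝ) ^ 2)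
    (haT3 : C0 (d + 1) * aT ≤ 1 / 3) (haT2 : 2 * aT ≤ c2' (d + 1) (ℓ + 1))
    (hεB : 2 * ((48 * ((d : ℝ) + 1) + 14 * d * M + (32 * ((d : ℝ) + 2) ^ 2 +
        12 * ((d : ℝ) + 1) ^ 2 * (13344 * ((d : ℝ) + 1) * ((d : ℝ) + 2) ^ 2 * ((d : ℝ) + 5) * (((ℓ + 1 : ℕ) : ℝ)) ^ (d + 4)) *
          (Cτ * (letI : CStarAlgebra (Matrix (Fin N) (Fin N) ℂ) := {}; betaTau τ)))) * aT) * B₀ ≤ 1)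
    {len : LSite (d + 1) → ℝ}
    {ι : Type} [Fintype ι] [DecidableEq ι] (b : Module.Basis ι ℝ (Matrix (Fin N) (Fin N) ℂ)) {M₂ : ℝ} (hM₂ : 0 ≤ M₂)
    (hrepr : ∀ (v : Matrix (Fin N) (Fin N) ℂ) (j : ι), |b.repr v j| ≤ M₂ * ‖v‖) (Rr : ℝ) (Hp : Prop) :
    letI : CStarAlgebra (Matrix (Fin N) (Fin N) ℂ) := {}
    ∃ a₀' : ℝ, 0 < a₀' ∧ ∃ k₀ : ℕ, ∃ cα : ℝ, 0 < cα ∧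
    ∀ cL : ℝ, 0 < cL → cL * (((ℓ + 1 : ℕ) : ℝ)) ^ 2 < a₀' →
      cL ≤ min (1 / 16) (min aT (min aT (1 / (2 * (2 * B₀) * (14 * ((d + 1 - 1 : ℕ) : ℝ)) * M + 1)))) → cL ≤ cα →
    ∃ B₁ B₂ c₁ : ℝ, 0 < B₁ ∧ 0 < B₂ ∧ 0 < c₁ ∧ ∀ (m K k : ℕ) (η : ℝ), 1 ≤ k → k + k₀ ≤ m + K → 0 < η →
      (∀ (i : KIdx d ℓ hd hL 1 1) (m' : ℕ), 1 ≤ m' → m' ≤ k → i.k = m' + 1 → (∀ x, i.D.lev x = m') →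
        i.cf = (((ℓ + 1 : ℕ) : ℝ)) ^ (m' + 1) →
        (∀ ι : IBondY i, i.w ι = i.cf ^ 2 * (((((ℓ + 1 : ℕ) : ℝ)) ^ (ι.1.1 : ℕ)) ^ (d + 1) * (1 / (((ℓ + 1 : ℕ) : ℝ)) ^ (ι.1.1 : ℕ)) ^ 2)) →
        (PV d ℓ i.m i.K hd hL).sitesPerDir 0 = (PV d ℓ m K hd hL).sitesPerDir 0 →
        ∀ (α₀ : ℝ) (U₀ : LSite (d + 1) → Fin (d + 1) → (Matrix (Fin N) (Fin N) ℂ)ˣ),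
        (∀ x κ, U₀ x κ ∈ B7Prop2Explicit.unitaryUnits (Matrix (Fin N) (Fin N) ℂ)) →
        IsPeriodic ((PV d ℓ m K hd hL).sitesPerDir 0) U₀ → 0 < α₀ → α₀ ≤ aT →
        InAk (ℓ + 1) m' η α₀ (fun _ => (Set.univ : Set (LSite (d + 1)))) U₀ →
          IsUnit (deltaAY i (parKnitY i) (parBY i) (GpY i (parKnitY i)) (bgY i U₀)) ∧
          (∀ F, wNormBY i (-1) (GAY i (parKnitY i) (parBY i) (GpY i (parKnitY i)) (bgY i U₀) F) ≤ B₀ * wNormBY i (-3) F) ∧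
          (∀ F ν, wNormBY i (-2) (cdB i (bgY i U₀) ν (GAY i (parKnitY i) (parBY i) (GpY i (parKnitY i)) (bgY i U₀) F)) ≤ B₀ * wNormBY i (-3) F) ∧
          (∀ F, wNormBY i (-3) (lapB i (bgY i U₀) (GAY i (parKnitY i) (parBY i) (GpY i (parKnitY i)) (bgY i U₀) F)) ≤ B₀ * wNormBY i (-3) F) ∧
          IsUnit (deltaPrimeAY i (parKnitY i) (bgY i U₀)) ∧ IsUnit (XY i (parKnitY i) (GpY i (parKnitY i)) (bgY i U₀))) →
      Thm2SetupSUAt (PV d ℓ m K hd hL) N k η 0 B₁ B₂ c₁ len (fun _ => True) := by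
  letI : CStarAlgebra (Matrix (Fin N) (Fin N) ℂ) := {}
  haveI : Nonempty (Fin N) := ⟨⟨0, Nat.pos_of_ne_zero (NeZero.ne N)⟩⟩
  -- [B8] Prop. 6 at the all-torus members (pub-ymgap, unconditional)
  obtain ⟨c35, c₆, K₆, hc35, hc₆, hK₆, hP6⟩ :=
    prop6At_bgZd_allTorus_holds (𝔸 := Matrix (Fin N) (Fin N) ℂ) (d := d + 1) hd2 (L := ℓ + 1) (by omega) hL.1
  -- G3
  obtain ⟨a₁, ha₁, a₀', ha₀', a, k₀, h8, H⟩ :=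
    thm2SetupSUAt_ofCubeData_deltaASide_exists (hd := hd) (hL := hL) (len := len) hN hd2 hℓ τ hτ hτt hCτ hM1 hB₀ haT haTQ haT3 haT2 hεB b hM₂ hrepr Rr Hp
  -- the smallness threshold for Prop. 6 at `M_h = L^a`: `MP = 10·L·L^a`
  set Lr : ℝ := ((ℓ + 1 : ℕ) : ℝ) with hLr
  set MP : ℝ := ((10 * (ℓ + 1) * (ℓ + 1) ^ a : ℕ) : ℝ) with hMP
  have hMP0 : 0 < MP := by rw [hMP]; positivity
  set D : ℝ := max 1 (1 + D1 thetaProf) with hD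
  have hD1 : 1 ≤ D := le_max_left _ _
  have hD0 : 0 < D := lt_of_lt_of_le one_pos hD1
  set cα : ℝ := min (c₆ / MP) (min a₁ (1 / 4) / (c35 * MP * K₆ * Lr ^ 2 * D + 1)) with hcα
  have hden : 0 < c35 * MP * K₆ * Lr ^ 2 * D + 1 := by positivity
  have hcα0 : 0 < cα := lt_min (div_pos hc₆ hMP0) (div_pos (lt_min ha₁ (by norm_num)) hden)
  refine ⟨a₀', ha₀', k₀, cα, hcα0, fun cL hcL hαe hcLP hcLα => ?_⟩
  obtain ⟨B₁, B₂, c₁, hB₁, hB₂, hc₁, HT⟩ := H cL hcL hαe hcLP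
  refine ⟨B₁, B₂, c₁, hB₁, hB₂, hc₁, fun m K k η hk hkK hη hΔ => HT m K k η hk hkK hη ?_ hΔ⟩
  -- (α): the per-cube (3.35) data from Prop. 6 through the carrier bridge G4
  intro i n hn hnk hD hkn hMh hcf hper α₀ hα₀ hα₀c U₀ hU₀G hU₀per hAk
  have hU₀ : ∀ x κ, U₀ x κ ∈ unitaryUnits (Matrix (Fin N) (Fin N) ℂ) := fun x κ => specialUnitaryUnits_le_unitaryUnits (hU₀G x κ)
  -- periodicity in the member's own period letter
  have hU₀per' : ∀ (x : LSite (d + 1)) (μ : Fin (d + 1)), U₀ (x + (((PV d ℓ i.m i.K hd hL).sitesPerDir 0 : ℕ) : ℤ) • e μ) = U₀ x := by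
    rw [hper]; exact hU₀per
  have hα₀α : α₀ ≤ cα := hα₀c.trans hcLα
  -- per cube
  have hcube : ∀ c : ↥(cubes (toKT i).D.toDomains),
      ∃ (g : GaugeY (Matrix (Fin N) (Fin N) ℂ) i) (A : AfldY (Matrix (Fin N) (Fin N) ℂ) i) (Q : Set (Site (PV d ℓ i.m i.K hd hL) 0)) (C ξ Λ : ℝ),
      (∀ x, ‖(g x : Matrix (Fin N) (Fin N) ℂ)‖ ≤ 1 ∧ ‖(((g x)⁻¹ : (Matrix (Fin N) (Fin N) ℂ)ˣ) : Matrix (Fin N) (Fin N) ℂ)‖ ≤ 1) ∧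
      0 ≤ C ∧ 0 < ξ ∧ 1 ≤ Λ ∧ ξ ≤ 5 * (SC i c : ℝ) * (kGeo i).eta ∧
      LatticeNorms.scaleLen ((ℓ : ℝ) + 1) (kGeo i).eta (c.1.1 + 1) ≤ Λ * ξ ∧
      (∀ x : Site (PV d ℓ i.m i.K hd hL) 0, NearC i c (35 * SC i c / 8 + 1) (boxEquiv i.hN x).1 → x ∈ Q) ∧
      (∀ (κ : Fin (d + 1)) (x : Site (PV d ℓ i.m i.K hd hL) 0), x ∈ Q → x.shift κ ∈ Q →
        gaugeY i g (bgY i U₀) κ x = fluct (kGeo i).eta A κ x) ∧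
      (∀ κ, ∀ x ∈ Q, ‖A κ x‖ ≤ C * ξ⁻¹) ∧
      (∀ μ ν, ∀ x ∈ Q,
        ‖(((kGeo i).eta : ℂ)⁻¹) • covD (shiftsV1 (PV d ℓ i.m i.K hd hL)) (fun _ _ => (1 : (Matrix (Fin N) (Fin N) ℂ)ˣ)) μ (A ν) x‖ ≤ C * (ξ ^ 2)⁻¹) ∧
      max C (C * (1 + D1 thetaProf)) * Λ ^ 2 ≤ a₁ ∧ max C (C * (1 + D1 thetaProf)) * Λ ^ 2 ≤ 1 / 4 := by
    intro c
    -- the cube's level is the member's constant level `n`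
    have hjn : c.1.1 = n := by
      obtain ⟨x, _, hx⟩ := Finset.mem_image.1 c.2
      have h1 : c.1.1 = (toKT i).D.lev x := (congrArg Prod.fst hx).symm
      rw [h1]; exact hD x
    -- Prop. 6's datum on the aligned cube containing the chart ball
    have hMhℕ : (toKT i).Mh = (ℓ + 1) ^ a := hMh
    have hsmall : ((10 * (ℓ + 1) * (toKT i).Mh : ℕ) : ℝ) * α₀ ≤ c₆ := by
      rw [hMhℕ, ← hMP]
      have h1 : α₀ ≤ c₆ / MP := hα₀α.trans (min_le_left _ _)
      rw [le_div_iff₀ hMP0] at h1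
      linarith
    have hAj : InAk (ℓ + 1) c.1.1 η α₀ (fun _ => (Set.univ : Set (LSite (d + 1)))) U₀ := by rw [hjn]; exact hAk
    obtain ⟨B, hB, h335⟩ := reg335Cube_ball_of_prop6At (hd := hd) (hL := hL) hP6 i c hη hα₀ hsmall hU₀ hAj
    -- the constant `C_Z = c35 · MP · K₆ · α₀`
    set CZ : ℝ := c35 * ((10 * (ℓ + 1) * (toKT i).Mh : ℕ) : ℝ) * (K₆ * α₀) with hCZ
    have hCZ' : CZ = c35 * MP * K₆ * α₀ := by rw [hCZ, hMhℕ, ← hMP]; ring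
    have hCZ0 : 0 ≤ CZ := by rw [hCZ']; positivity
    -- the (3.37) sizes from `α₀ ≤ c_α`
    have hkey : CZ * Lr ^ 2 * D ≤ min a₁ (1 / 4) := by
      have h1 : α₀ ≤ min a₁ (1 / 4) / (c35 * MP * K₆ * Lr ^ 2 * D + 1) := hα₀α.trans (min_le_right _ _)
      rw [le_div_iff₀ hden] at h1
      have h2 : CZ * Lr ^ 2 * D = α₀ * (c35 * MP * K₆ * Lr ^ 2 * D) := by rw [hCZ']; ring
      rw [h2]
      nlinarith [hα₀.le]
    have hmax : max (CZ * Lr ^ 2) (CZ * Lr ^ 2 * (1 + D1 thetaProf)) ≤ CZ * Lr ^ 2 * D := by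
      refine max_le ?_ ?_
      · have : CZ * Lr ^ 2 * 1 ≤ CZ * Lr ^ 2 * D := mul_le_mul_of_nonneg_left hD1 (by positivity)
        linarith
      · exact mul_le_mul_of_nonneg_left (le_max_right _ _) (by positivity)
    have hsz₁ : max (CZ * Lr ^ 2) (CZ * Lr ^ 2 * (1 + D1 thetaProf)) ≤ a₁ := hmax.trans (hkey.trans (min_le_left _ _))
    have hsz₄ : max (CZ * Lr ^ 2) (CZ * Lr ^ 2 * (1 + D1 thetaProf)) ≤ 1 / 4 := hmax.trans (hkey.trans (min_le_right _ _))
    -- the room inequality: `N = M_h·L^{k+1}·P′ ≥ 25 S_n`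
    have hroom : (35 * SC i c / 8 + 3) * 2 ≤ (((PV d ℓ i.m i.K hd hL).sitesPerDir 0 : ℕ) : ℤ) := by
      have hSC9 := nine_le_SC i c
      have hNB : B6MultiLevelBoxOperator.N0 ℓ i.Mh i.k i.P' 0 = (PV d ℓ i.m i.K hd hL).sitesPerDir 0 := i.hN 0
      have hP5 : 5 ≤ i.P' 0 := i.hP5 0
      have h25 : 5 * 5 ≤ (ℓ + 1) * i.P' 0 := Nat.mul_le_mul (by omega) hP5
      have hNnat : 25 * (i.Mh * (ℓ + 1) ^ (n + 1)) ≤ B6MultiLevelBoxOperator.N0 ℓ i.Mh i.k i.P' 0 := by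
        show 25 * (i.Mh * (ℓ + 1) ^ (n + 1)) ≤ (ℓ + 1) ^ i.k * ((ℓ + 1) * (i.Mh * i.P' 0))
        rw [hkn]
        calc 25 * (i.Mh * (ℓ + 1) ^ (n + 1)) ≤ ((ℓ + 1) * i.P' 0) * (i.Mh * (ℓ + 1) ^ (n + 1)) := Nat.mul_le_mul_right _ h25
          _ = (ℓ + 1) ^ (n + 1) * ((ℓ + 1) * (i.Mh * i.P' 0)) := by ring
      rw [hNB] at hNnat
      have hSC : SC i c = ((i.Mh * (ℓ + 1) ^ (n + 1) : ℕ) : ℤ) := by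
        show ((B6MultiLevelBoxOperator.bigSide ℓ (toKT i).Mh c.1.1 : ℕ) : ℤ) = _
        rw [hjn]; rfl
      have hN' : ((25 * (i.Mh * (ℓ + 1) ^ (n + 1)) : ℕ) : ℤ) ≤ (((PV d ℓ i.m i.K hd hL).sitesPerDir 0 : ℕ) : ℤ) := Int.ofNat_le.mpr hNnat
      rw [Nat.cast_mul, ← hSC] at hN'
      omega
    exact cubeDatum_of_reg335Zd i c hU₀per' hη hCZ0 hsz₁ hsz₄ hroom hB h335
  choose g A Q C ξ Λ hg hC hξ hΛ hξS hΛξ hQ hgA hAb hdA hs₁ hs₄ using hcube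
  exact ⟨g, A, Q, C, ξ, Λ, fun c x => hg c x, hC, hξ, hΛ, hξS, hΛξ, hQ, hgA, hAb, hdA, hs₁, hs₄⟩

end Setup

/-! ## §3 ★★★★★ The `hThm2` binder of the 19200 dictionary (`d + 1 = 3`, `N = 2`), (3.35) dropped, for the families with `k₀ ≤ F.m + n` -/

section Binder

variable {hd₃ : 1 ≤ 2 + 1}
variable [instF : ∀ i : KIdx 2 ℓ hd₃ hL 1 1, Fintype (geo9K i).Site] [instD : ∀ i : KIdx 2 ℓ hd₃ hL 1 1, DecidableEq (geo9K i).Site]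

/-- ★★★★★ **THE `hThm2` BINDER OF THE 19200 DICTIONARY FROM THE Δ_a-SIDE MEMBERS ALONE, FOR THE FAMILIES WITH `k₀ ≤ F.m + n`** (§2 at `d + 1 = 3`, `N = 2`, read
at `(m, K, k, η) := (F.m, K, K − n, L^{−(K−n)})` through `F.P K = PV 2 ℓ F.m K`): `∃ a₀′ > 0, ∃ k₀, ∃ c_α > 0, ∀ c_L …, ∃ B₁ B₂ c₁ > 0, ∀ F : T3Family`, `F.L = ℓ + 1`
→ `∀ n < K`, `k₀ ≤ F.m + n` → (Δa) → `∃ β₀ B₂′ len′, Thm2SetupSUAt (F.P K) 2 (K − n) (eta F n K) β₀ B₁ B₂′ c₁ len′ (fun _ => True)` — the hypothesis of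
`Prop7SPrintThm2Dict.prop2Printed_sPrint_of_thm2SetupSUAt` for those families, modulo (Δa).  HONEST SCOPE as §2; `stub_PV3A` NOT discharged; the Yang–Mills
mass gap is NOT proved.
[cite: Balaban1985RegularSpaces, Thm 2 p.83, (1.33)–(1.39) pp.82–83, Prop. 6 p.99, p.77 («Ω_j = T_η»), p.76; Balaban1985BackgroundPropagators, (3.35)–(3.37) p.396, Thm 3.3 p.399, Thm 3.4 p.400, Thm 3.11 p.416; Balaban1985UV3, (1)–(3) p.256; Balaban1984PropagatorsII, (2.1)–(2.4) p.224] -/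
theorem hThm2_of_prop6_deltaASide (hℓ : 4 ≤ ℓ)
    (τ : Matrix (Fin 2) (Fin 2) ℂ →ₗ[ℂ] ℂ) (hτ : ∀ a, τ a = Matrix.trace a) (hτt : ∀ a b, τ (a * b) = τ (b * a))
    {Cτ : ℝ} (hCτ : ∀ x y : Matrix (Fin 2) (Fin 2) ℂ, |(τ (star x * y)).re| ≤ Cτ * ‖x‖ * ‖y‖)
    {M : ℝ} (hM1 : 1 ≤ M) {B₀ aT : ℝ} (hB₀ : 0 < B₀) (haT : 0 < aT) (haTQ : aT ≤ alphaQ (2 + 1) (ℓ + 1) / ((ℓ + 1 : ℕ) : ℝ) ^ 2)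
    (haT3 : C0 (2 + 1) * aT ≤ 1 / 3) (haT2 : 2 * aT ≤ c2' (2 + 1) (ℓ + 1))
    (hεB : 2 * ((48 * (((2 : ℕ) : ℝ) + 1) + 14 * ((2 : ℕ) : ℝ) * M + (32 * (((2 : ℕ) : ℝ) + 2) ^ 2 +
        12 * (((2 : ℕ) : ℝ) + 1) ^ 2 * (13344 * (((2 : ℕ) : ℝ) + 1) * (((2 : ℕ) : ℝ) + 2) ^ 2 * (((2 : ℕ) : ℝ) + 5) * (((ℓ + 1 : ℕ) : ℝ)) ^ (2 + 4)) *
          (Cτ * (letI : CStarAlgebra (Matrix (Fin 2) (Fin 2) ℂ) := {}; betaTau τ)))) * aT) * B₀ ≤ 1)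
    {len : LSite (2 + 1) → ℝ}
    {ι : Type} [Fintype ι] [DecidableEq ι] (b : Module.Basis ι ℝ (Matrix (Fin 2) (Fin 2) ℂ)) {M₂ : ℝ} (hM₂ : 0 ≤ M₂)
    (hrepr : ∀ (v : Matrix (Fin 2) (Fin 2) ℂ) (j : ι), |b.repr v j| ≤ M₂ * ‖v‖) (Rr : ℝ) (Hp : Prop) :
    letI : CStarAlgebra (Matrix (Fin 2) (Fin 2) ℂ) := {}
    ∃ a₀' : ℝ, 0 < a₀' ∧ ∃ k₀ : ℕ, ∃ cα : ℝ, 0 < cα ∧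
    ∀ cL : ℝ, 0 < cL → cL * (((ℓ + 1 : ℕ) : ℝ)) ^ 2 < a₀' →
      cL ≤ min (1 / 16) (min aT (min aT (1 / (2 * (2 * B₀) * (14 * ((2 + 1 - 1 : ℕ) : ℝ)) * M + 1)))) → cL ≤ cα →
    ∃ B₁ B₂ c₁ : ℝ, 0 < B₁ ∧ 0 < B₂ ∧ 0 < c₁ ∧
    ∀ F : T3Family, F.L = ℓ + 1 → ∀ (n K : ℕ), n < K → k₀ ≤ F.m + n →
      (∀ (i : KIdx 2 ℓ hd₃ hL 1 1) (m' : ℕ), 1 ≤ m' → m' ≤ K - n → i.k = m' + 1 → (∀ x, i.D.lev x = m') →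
        i.cf = (((ℓ + 1 : ℕ) : ℝ)) ^ (m' + 1) →
        (∀ ι : IBondY i, i.w ι = i.cf ^ 2 * (((((ℓ + 1 : ℕ) : ℝ)) ^ (ι.1.1 : ℕ)) ^ (2 + 1) * (1 / (((ℓ + 1 : ℕ) : ℝ)) ^ (ι.1.1 : ℕ)) ^ 2)) →
        (PV 2 ℓ i.m i.K hd₃ hL).sitesPerDir 0 = (PV 2 ℓ F.m K hd₃ hL).sitesPerDir 0 →
        ∀ (α₀ : ℝ) (U₀ : LSite (2 + 1) → Fin (2 + 1) → (Matrix (Fin 2) (Fin 2) ℂ)ˣ),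
        (∀ x κ, U₀ x κ ∈ B7Prop2Explicit.unitaryUnits (Matrix (Fin 2) (Fin 2) ℂ)) →
        IsPeriodic ((PV 2 ℓ F.m K hd₃ hL).sitesPerDir 0) U₀ → 0 < α₀ → α₀ ≤ aT →
        InAk (ℓ + 1) m' (eta F n K) α₀ (fun _ => (Set.univ : Set (LSite (2 + 1)))) U₀ →
          IsUnit (deltaAY i (parKnitY i) (parBY i) (GpY i (parKnitY i)) (bgY i U₀)) ∧
          (∀ F', wNormBY i (-1) (GAY i (parKnitY i) (parBY i) (GpY i (parKnitY i)) (bgY i U₀) F') ≤ B₀ * wNormBY i (-3) F') ∧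
          (∀ F' ν, wNormBY i (-2) (cdB i (bgY i U₀) ν (GAY i (parKnitY i) (parBY i) (GpY i (parKnitY i)) (bgY i U₀) F')) ≤ B₀ * wNormBY i (-3) F') ∧
          (∀ F', wNormBY i (-3) (lapB i (bgY i U₀) (GAY i (parKnitY i) (parBY i) (GpY i (parKnitY i)) (bgY i U₀) F')) ≤ B₀ * wNormBY i (-3) F') ∧
          IsUnit (deltaPrimeAY i (parKnitY i) (bgY i U₀)) ∧ IsUnit (XY i (parKnitY i) (GpY i (parKnitY i)) (bgY i U₀))) →
      ∃ (β₀ B₂' : ℝ) (len' : LSite (F.P K).d → ℝ),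
        Thm2SetupSUAt (F.P K) 2 (K - n) (eta F n K) β₀ B₁ B₂' c₁ len' (fun _ => True) := by
  letI : CStarAlgebra (Matrix (Fin 2) (Fin 2) ℂ) := {}
  obtain ⟨a₀', ha₀', k₀, cα, hcα, H⟩ :=
    thm2SetupSUAt_ofProp6_deltaASide_exists (d := 2) (hd := hd₃) (hL := hL) (len := len) (by norm_num) (by norm_num) hℓ τ hτ hτt hCτ hM1 hB₀
      haT haTQ haT3 haT2 hεB b hM₂ hrepr Rr Hp
  refine ⟨a₀', ha₀', k₀, cα, hcα, fun cL hcL hαe hcLP hcLα => ?_⟩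
  obtain ⟨B₁, B₂, c₁, hB₁, hB₂, hc₁, HT⟩ := H cL hcL hαe hcLP hcLα
  refine ⟨B₁, B₂, c₁, hB₁, hB₂, hc₁, fun F hF n K hnK hm hΔ => ?_⟩
  have hT : Thm2SetupSUAt (PV 2 ℓ F.m K hd₃ hL) 2 (K - n) (eta F n K) 0 B₁ B₂ c₁ len (fun _ => True) :=
    HT F.m K (K - n) (eta F n K) (by omega) (by omega) (eta_pos F n K) hΔ
  rw [P_eq_PV (hd := hd₃) (hL := hL) F hF K]
  exact ⟨0, B₂, len, hT⟩

end Binder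

end Literature.MathematicalPhysics.QuantumFieldTheory.Balaban1983to89.B8Thm2TorusOfProp6DeltaASide

end
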